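import Literature.NumberTheory.EllipticCurves.SzpiroNumberFieldLocalProofs
import Literature.NumberTheory.EllipticCurves.SzpiroNumberFieldLocalDegenerateProofs
import Literature.NumberTheory.EllipticCurves.Szpiro
import Literature.NumberTheory.DiophantineGeometry.GenEllVojtaNumberFieldPoints
import Literature.NumberTheory.DiophantineGeometry.FibreConductorSummation
import Literature.NumberTheory.DiophantineGeometry.MinimalDiscriminantFiniteProofs
import Literature.NumberTheory.DiophantineGeometry.MinimalDiscriminantProofs
import HarnessLib

/-!
# `abc ⟹ Szpiro` over a number field, III: Vojta's height inequality for `ℙ¹ ∖ {0,1,∞}` at degree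
# `[K:ℚ]` implies Szpiro's conjecture over `K`

Companion PROOF file (theorems only) of `Literature.NumberTheory.EllipticCurves.Szpiro`: the number-field
form of Silverman AEC Prop. VIII.11.5(b) «the abc conjecture implies Szpiro's conjecture» (with
Ex. 8.21), for `SzpiroConjectureOver K` (Silverman ATAEC Conj. IV.10.6), the abc input being
Vojta's height inequality on `U_{ℙ¹∖{0,1,∞}}(Q̄)^{≤[K:ℚ]}` ([GenEll] Thm. 2.1 (i), `GenEll.VojtaP1Deg`):

* `WeierstrassCurve.szpiroConjectureOver_of_vojtaP1Deg :
    GenEll.VojtaP1Deg [K:ℚ] → SzpiroConjectureOver K`.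

Proof. Sum the local inequalities of parts II/IIb (`szpiro_local_ineq`,
`szpiro_local_ineq_degenerate`) over a finite set of places containing the bad places, the bad
primes of `x = c₄³/(1728Δ)` and the places above `6`: with `D = log N(𝔇_min)`, `N = log N(𝔣)`,
`Δ = Σ_{w bad for x} log N(w)`, `H = h_K(x)`, this gives `D + 6Δ ≤ 6N + 6H + O_K(1)` and
`6Δ ≤ 6N + 5H + O_K(1)` (the three finite height sums are `≤ h_K(x), h_K(x), h_K(1−x)`,
`FibreConductor.sum_toNat_ord_mul_logNorm_le_logHeight₁`), while abc over `K`
(`GenEll.abc_numberField_of_vojtaP1Deg`) gives `H ≤ (1+ε)Δ + O_{K,ε}(1)`; eliminating `H` and `Δ`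
yields `D ≤ (6 + 72ε) N + O(1)` for `ε ≤ 1/10`, i.e. `N(𝔇_min) ≤ C · N(𝔣)^{6+η}` with `ε = min(1/10, η/72)`.

## References

* J. H. Silverman, *The Arithmetic of Elliptic Curves*, GTM 106, 2nd ed. 2009, Prop. VIII.11.5(b),
  Ex. 8.21. [SilvermanAEC2009]
* J. H. Silverman, *Advanced Topics in the Arithmetic of Elliptic Curves*, GTM 151, 1994, Conj. IV.10.6.
  [Silverman1994]
-/

noncomputable section

open NumberField IsDedekindDomain Height Module Real
open Literature.NumberTheory.DiophantineGeometry Literature.NumberTheory.DiophantineGeometry.GenEll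
open Literature.NumberTheory.EllipticCurves Literature.IUT.LogVolume

namespace WeierstrassCurve

section Helpers

variable {K : Type} [Field K] [NumberField K]

/-- `log N(∏ᶠ_w w^{e_w}) = Σ_{w ∈ T} e_w · log N(w)` for `T` containing the support of `e`. [folklore] -/
private theorem log_absNorm_finprod_pow (e : HeightOneSpectrum (𝓞 K) → ℕ)
    (T : Finset (HeightOneSpectrum (𝓞 K))) (hT : ∀ w, e w ≠ 0 → w ∈ T) :
    Real.log (Ideal.absNorm (∏ᶠ w : HeightOneSpectrum (𝓞 K), w.asIdeal ^ e w) : ℝ) =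
      ∑ w ∈ T, (e w : ℝ) * logNorm K w := by
  have hsub : (Function.mulSupport fun w : HeightOneSpectrum (𝓞 K) => w.asIdeal ^ e w) ⊆ T := by
    intro w hw
    refine Finset.mem_coe.mpr (hT w fun h => hw ?_)
    simp [h]
  rw [finprod_eq_prod_of_mulSupport_subset _ hsub, map_prod, Nat.cast_prod, Real.log_prod]
  · refine Finset.sum_congr rfl fun w _ => ?_
    rw [map_pow, Nat.cast_pow, Real.log_pow]; rfl
  · intro w _
    rw [map_pow, Nat.cast_pow]
    exact pow_ne_zero _ (Nat.cast_ne_zero.mpr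
      (by rw [Ne, Ideal.absNorm_eq_zero_iff]; exact w.ne_bot))

/-- `log⁺ ‖y‖_w = ord⁺_w(y⁻¹) · log N(w)`. [folklore] -/
private theorem log_max_one_mk_eq (w : HeightOneSpectrum (𝓞 K)) (y : K) :
    Real.log (max 1 (FinitePlace.mk w y)) = ((ord K w y⁻¹).toNat : ℝ) * logNorm K w := by
  have h := Literature.NumberTheory.DiophantineGeometry.FibreConductor.posLog_adicAbv_inv_eq w y⁻¹
  rw [inv_inv] at h
  rw [← Real.posLog_eq_log_max_one (apply_nonneg _ _), FinitePlace.mk_apply,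
    FinitePlace.norm_embedding]
  exact h

/-- `v(r) = exp(−n)` for the natural number `n = ord_v(r)` of an element of `𝓞 K ∖ {0}`. [folklore] -/
private theorem valuation_eq_exp_neg_toNat (v : HeightOneSpectrum (𝓞 K)) {r : K}
    (hr : r ≠ 0) (hle : v.valuation K r ≤ 1) :
    v.valuation K r = WithZero.exp (-((-(WithZero.log (v.valuation K r))).toNat : ℤ)) := by
  have h0 : v.valuation K r ≠ 0 := (Valuation.ne_zero_iff _).mpr hr
  have hlog : WithZero.log (v.valuation K r) ≤ 0 := by
    rw [← WithZero.exp_le_exp, WithZero.exp_log h0, WithZero.exp_zero]; exact hle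
  rw [Int.toNat_of_nonneg (by omega), neg_neg, WithZero.exp_log h0]

end Helpers

section Main

variable (K : Type) [Field K] [NumberField K]

open scoped Classical in
/-- **`abc ⟹ Szpiro` over a number field** (Silverman AEC Prop. VIII.11.5(b) with Ex. 8.21, for the
number-field conjecture ATAEC IV.10.6): Vojta's height inequality for `ℙ¹ ∖ {0,1,∞}` on points of
degree `≤ [K:ℚ]` ([GenEll] Thm. 2.1 (i), the `d = [K:ℚ]` case of the strong abc conjecture) implies
Szpiro's conjecture `N(𝔇_min) ≤ C(K,ε)·N(𝔣)^{6+ε}` for all elliptic curves over `K`. An implication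
between statements; nothing is asserted about either side.
[cite: SilvermanAEC2009, Prop. VIII.11.5(b) and Ex. 8.21] -/
theorem szpiroConjectureOver_of_vojtaP1Deg (hV : VojtaP1Deg (finrank ℚ K)) :
    SzpiroConjectureOver K := by
  intro η hη
  -- the auxiliary `ε`
  set ε : ℝ := min (1 / 10) (η / 72) with hεdef
  have hε : 0 < ε := lt_min (by norm_num) (by positivity)
  have hε10 : ε ≤ 1 / 10 := min_le_left _ _
  have hε72 : ε ≤ η / 72 := min_le_right _ _
  obtain ⟨Cabc, habc⟩ := abc_numberField_of_vojtaP1Deg K hV hε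
  set Cabc' : ℝ := max Cabc 0 with hCabc'
  have hCabc'0 : 0 ≤ Cabc' := le_max_right _ _
  have habc' : ∀ x : K, x ≠ 0 → x ≠ 1 → ∀ T : Finset (HeightOneSpectrum (𝓞 K)),
      (∀ w, w ∈ badPrimes x (1 - x) 1 → w ∈ T) →
        logHeight₁ x ≤ (1 + ε) * ∑ w ∈ T, Real.log (Ideal.absNorm w.asIdeal : ℝ) + Cabc' :=
    fun x h0 h1 T hT => (habc x h0 h1 T hT).trans (by gcongr; exact le_max_left _ _)
  -- the orders of `2` and `3` at each place, and the places above `6`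
  set t₂ : HeightOneSpectrum (𝓞 K) → ℕ := fun w => (-(WithZero.log (w.valuation K (2 : K)))).toNat
    with ht₂def
  set t₃ : HeightOneSpectrum (𝓞 K) → ℕ := fun w => (-(WithZero.log (w.valuation K (3 : K)))).toNat
    with ht₃def
  have h2le : ∀ w : HeightOneSpectrum (𝓞 K), w.valuation K (2 : K) ≤ 1 := fun w => by
    have h : w.valuation K (algebraMap (𝓞 K) K 2) ≤ 1 := w.valuation_le_one 2
    rwa [map_ofNat] at h
  have h3le : ∀ w : HeightOneSpectrum (𝓞 K), w.valuation K (3 : K) ≤ 1 := fun w => by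
    have h : w.valuation K (algebraMap (𝓞 K) K 3) ≤ 1 := w.valuation_le_one 3
    rwa [map_ofNat] at h
  have ht₂ : ∀ w, w.valuation K (2 : K) = WithZero.exp (-(t₂ w : ℤ)) := fun w =>
    valuation_eq_exp_neg_toNat w (by norm_num) (h2le w)
  have ht₃ : ∀ w, w.valuation K (3 : K) = WithZero.exp (-(t₃ w : ℤ)) := fun w =>
    valuation_eq_exp_neg_toNat w (by norm_num) (h3le w)
  set c : HeightOneSpectrum (𝓞 K) → ℝ := fun w =>
    if t₂ w + t₃ w = 0 then (0 : ℝ) else 3 * (6 * t₂ w + 3 * t₃ w) + 5 with hcdef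
  have hc0 : ∀ w, 0 ≤ c w := fun w => by
    simp only [hcdef]; split_ifs <;> positivity
  have h6ne : (Ideal.span {(6 : 𝓞 K)} : Ideal (𝓞 K)) ≠ 0 := by
    rw [Ne, Ideal.zero_eq_bot, Ideal.span_singleton_eq_bot]; norm_num
  have hT₆fin := Ideal.finite_factors h6ne
  set T₆ : Finset (HeightOneSpectrum (𝓞 K)) := hT₆fin.toFinset with hT₆
  have hc_off : ∀ w, w ∉ T₆ → c w = 0 := by
    intro w hw
    have hw' : ¬ w.asIdeal ∣ Ideal.span {(6 : 𝓞 K)} := fun h => hw (hT₆fin.mem_toFinset.mpr h)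
    rw [Ideal.dvd_span_singleton] at hw'
    have h2 : t₂ w = 0 := by
      by_contra h
      apply hw'
      have hlt : w.valuation K (2 : K) < 1 := by
        rw [ht₂ w, ← WithZero.exp_zero, WithZero.exp_lt_exp]; omega
      have hmem : (2 : 𝓞 K) ∈ w.asIdeal := by
        have h' : w.valuation K (algebraMap (𝓞 K) K 2) < 1 := by rwa [map_ofNat]
        exact (w.valuation_lt_one_iff_mem 2).mp h'
      simpa [show (6 : 𝓞 K) = 3 * 2 by norm_num] using w.asIdeal.mul_mem_left 3 hmem
    have h3 : t₃ w = 0 := by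
      by_contra h
      apply hw'
      have hlt : w.valuation K (3 : K) < 1 := by
        rw [ht₃ w, ← WithZero.exp_zero, WithZero.exp_lt_exp]; omega
      have hmem : (3 : 𝓞 K) ∈ w.asIdeal := by
        have h' : w.valuation K (algebraMap (𝓞 K) K 3) < 1 := by rwa [map_ofNat]
        exact (w.valuation_lt_one_iff_mem 3).mp h'
      simpa [show (6 : 𝓞 K) = 2 * 3 by norm_num] using w.asIdeal.mul_mem_left 2 hmem
    simp [hcdef, h2, h3]
  set C₁ : ℝ := ∑ w ∈ T₆, 6 * c w * logNorm K w with hC₁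
  have hC₁0 : 0 ≤ C₁ := Finset.sum_nonneg fun w _ =>
    mul_nonneg (mul_nonneg (by norm_num) (hc0 w)) (logNorm_pos K w).le
  set L2 : ℝ := finrank ℚ K * Real.log 2 with hL2
  have hL20 : 0 ≤ L2 := mul_nonneg (Nat.cast_nonneg _) (Real.log_nonneg (by norm_num))
  set Cfin : ℝ := 16 * Cabc' + 9 * L2 + 18 * C₁ with hCfin
  refine ⟨Real.exp Cfin, fun W _ => ?_⟩
  -- the curve
  have hDpos : (0 : ℝ) < W.minimalDiscriminantNorm (𝓞 K) := by
    have : W.minimalDiscriminantNorm (𝓞 K) ≠ 0 := by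
      unfold minimalDiscriminantNorm
      rw [Ne, Ideal.absNorm_eq_zero_iff]
      exact minimalDiscriminantIdeal_ne_bot_holds (𝓞 K) W
    exact_mod_cast Nat.pos_of_ne_zero this
  have hNpos : (0 : ℝ) < W.conductorNorm (𝓞 K) := by
    have : W.conductorNorm (𝓞 K) ≠ 0 := by
      unfold conductorNorm
      rw [Ne, Ideal.absNorm_eq_zero_iff]
      exact conductor_ne_bot (𝓞 K) W
    exact_mod_cast Nat.pos_of_ne_zero this
  have hN1 : (1 : ℝ) ≤ W.conductorNorm (𝓞 K) := by
    exact_mod_cast Nat.one_le_iff_ne_zero.mpr (by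
      unfold conductorNorm; rw [Ne, Ideal.absNorm_eq_zero_iff]; exact conductor_ne_bot (𝓞 K) W)
  set D : ℝ := Real.log (W.minimalDiscriminantNorm (𝓞 K)) with hDdef
  set N : ℝ := Real.log (W.conductorNorm (𝓞 K)) with hNdef
  have hN0 : 0 ≤ N := Real.log_nonneg hN1
  -- it suffices to prove `D ≤ (6 + η) N + Cfin`
  suffices hmain : D ≤ (6 + η) * N + Cfin by
    have e1 : (W.minimalDiscriminantNorm (𝓞 K) : ℝ) = Real.exp D := (Real.exp_log hDpos).symm
    have e2 : (W.conductorNorm (𝓞 K) : ℝ) ^ (6 + η) = Real.exp ((6 + η) * N) := by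
      rw [Real.rpow_def_of_pos hNpos, mul_comm]
    rw [e1, e2, ← Real.exp_add]
    exact Real.exp_le_exp.mpr (by linarith)
  -- the finite set of bad places and the sums `D`, `N`
  have hfinbad := finite_setOf_ordMinimalDiscriminant_ne_zero_holds (A := 𝓞 K) W
  set Tbad : Finset (HeightOneSpectrum (𝓞 K)) := hfinbad.toFinset with hTbad
  have hDsum : ∀ T : Finset (HeightOneSpectrum (𝓞 K)), Tbad ⊆ T →
      D = ∑ w ∈ T, (W.ordMinimalDiscriminant w : ℝ) * logNorm K w := by
    intro T hT
    rw [hDdef]; unfold minimalDiscriminantNorm minimalDiscriminantIdeal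
    exact log_absNorm_finprod_pow _ T fun w hw => hT (hfinbad.mem_toFinset.mpr hw)
  have hNsum : ∀ T : Finset (HeightOneSpectrum (𝓞 K)), Tbad ⊆ T →
      N = ∑ w ∈ T, (W.conductorExponent w : ℝ) * logNorm K w := by
    intro T hT
    rw [hNdef]; unfold conductorNorm WeierstrassCurve.conductor
    refine log_absNorm_finprod_pow _ T fun w hw => hT (hfinbad.mem_toFinset.mpr ?_)
    exact fun h => hw (Nat.eq_zero_of_le_zero (h ▸ conductorExponent_le_ordMinimalDiscriminant w W))
  have hCsum : ∀ T : Finset (HeightOneSpectrum (𝓞 K)), T₆ ⊆ T →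
      ∑ w ∈ T, 6 * c w * logNorm K w = C₁ := by
    intro T hT
    rw [hC₁]
    exact (Finset.sum_subset hT fun w _ hw => by rw [hc_off w hw]; ring).symm
  by_cases hdeg : W.c₄ = 0 ∨ W.c₆ = 0
  · -- degenerate case: `D ≤ 6 N + C₁`
    set T := Tbad ∪ T₆ with hTdef
    have hloc : ∀ w ∈ T, (W.ordMinimalDiscriminant w : ℝ) * logNorm K w ≤
        6 * ((W.conductorExponent w : ℝ) * logNorm K w) + 6 * c w * logNorm K w := by
      intro w _
      have h := szpiro_local_ineq_degenerate w W hdeg (t₂ w) (t₃ w) (ht₂ w) (ht₃ w)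
      simp only [hcdef, logNorm] at h ⊢
      linarith
    have hsum := Finset.sum_le_sum hloc
    rw [Finset.sum_add_distrib, ← Finset.mul_sum, ← hDsum T Finset.subset_union_left,
      ← hNsum T Finset.subset_union_left, hCsum T Finset.subset_union_right] at hsum
    have : 6 * N ≤ (6 + η) * N := by nlinarith
    rw [hCfin]; linarith
  · -- main case: `c₄ c₆ ≠ 0`
    push Not at hdeg
    obtain ⟨hc4, hc6⟩ := hdeg
    set x : K := W.c₄ ^ 3 / (1728 * W.Δ) with hxdef
    have hΔ0 : W.Δ ≠ 0 := W.isUnit_Δ.ne_zero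
    have h1728 : (1728 : K) ≠ 0 := by norm_num
    have hx0 : x ≠ 0 := div_ne_zero (pow_ne_zero 3 hc4) (mul_ne_zero h1728 hΔ0)
    have h1x : 1 - x = -(W.c₆ ^ 2 / (1728 * W.Δ)) := by
      rw [hxdef, one_sub_div (mul_ne_zero h1728 hΔ0),
        show 1728 * W.Δ - W.c₄ ^ 3 = -(W.c₆ ^ 2) by linear_combination W.c_relation, neg_div]
    have hx1 : x ≠ 1 := by
      intro h
      have : (1 : K) - x = 0 := by rw [h, sub_self]
      rw [h1x, neg_eq_zero] at this
      exact div_ne_zero (pow_ne_zero 2 hc6) (mul_ne_zero h1728 hΔ0) this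
    have h1x0 : 1 - x ≠ 0 := sub_ne_zero.mpr (Ne.symm hx1)
    -- bad primes of `x`
    have hBfin : (badPrimes x (1 - x) 1).Finite := by
      have h := (⟨K, x⟩ : NFPoint).condSupport_finite ⟨hx0, hx1⟩
      rwa [NFPoint.condSupport_eq_badPrimes] at h
    set B : Finset (HeightOneSpectrum (𝓞 K)) := hBfin.toFinset with hBdef
    set T := Tbad ∪ T₆ ∪ B with hTdef
    have hTbad : Tbad ⊆ T := Finset.subset_union_left.trans Finset.subset_union_left
    have hT₆ : T₆ ⊆ T := Finset.subset_union_right.trans Finset.subset_union_left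
    have hBT : ∀ w, w ∈ badPrimes x (1 - x) 1 → w ∈ T := fun w hw =>
      Finset.mem_union_right _ (hBfin.mem_toFinset.mpr hw)
    -- notation for the summands
    set δL : HeightOneSpectrum (𝓞 K) → ℝ := fun w =>
      if w ∈ badPrimes x (1 - x) 1 then Real.log (Ideal.absNorm w.asIdeal : ℝ) else 0 with hδL
    set Δ : ℝ := ∑ w ∈ T, δL w with hΔdef
    set H : ℝ := logHeight₁ x with hHdef
    -- the three height sums
    have hP : ∑ w ∈ T, Real.log (max 1 (FinitePlace.mk w x)) ≤ H := by
      simp only [log_max_one_mk_eq]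
      exact (FibreConductor.sum_toNat_ord_mul_logNorm_le_logHeight₁ x⁻¹ T).trans
        (logHeight₁_inv x).le
    have hQ : ∑ w ∈ T, Real.log (max 1 (FinitePlace.mk w x⁻¹)) ≤ H := by
      simp only [log_max_one_mk_eq, inv_inv]
      exact FibreConductor.sum_toNat_ord_mul_logNorm_le_logHeight₁ x T
    have hR : ∑ w ∈ T, Real.log (max 1 (FinitePlace.mk w (1 - x)⁻¹)) ≤ H + L2 := by
      simp only [log_max_one_mk_eq, inv_inv]
      refine (FibreConductor.sum_toNat_ord_mul_logNorm_le_logHeight₁ (1 - x) T).trans ?_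
      have h := logHeight₁_sub_le (1 : K) x
      rw [logHeight₁_one, NumberField.totalWeight_eq_finrank] at h
      rw [hL2]; linarith
    -- abc over `K`
    have hABC : H ≤ (1 + ε) * Δ + Cabc' := by
      have h := habc' x hx0 hx1 (T.filter (· ∈ badPrimes x (1 - x) 1))
        (fun w hw => Finset.mem_filter.mpr ⟨hBT w hw, hw⟩)
      rwa [Finset.sum_filter] at h
    -- the local inequalities, summed
    have hS1 : D + 6 * Δ ≤ 6 * N + 6 * H + 3 * L2 + 6 * C₁ := by
      have hloc : ∀ w ∈ T, (W.ordMinimalDiscriminant w : ℝ) * logNorm K w + 6 * δL w ≤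
          6 * ((W.conductorExponent w : ℝ) * logNorm K w) + Real.log (max 1 (FinitePlace.mk w x))
          + 2 * Real.log (max 1 (FinitePlace.mk w x⁻¹))
          + 3 * Real.log (max 1 (FinitePlace.mk w (1 - x)⁻¹)) + 6 * c w * logNorm K w := by
        intro w _
        have h := (szpiro_local_ineq w W hc4 hc6 x rfl (t₂ w) (t₃ w) (ht₂ w) (ht₃ w)).1
        simp only [hcdef, hδL, logNorm] at h ⊢
        linarith
      have hsum := Finset.sum_le_sum hloc
      simp only [Finset.sum_add_distrib, ← Finset.mul_sum] at hsum
      rw [← hDsum T hTbad, ← hNsum T hTbad, hCsum T hT₆] at hsum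
      linarith
    have hS2 : 6 * Δ ≤ 6 * N + 5 * H + 3 * L2 + 6 * C₁ := by
      have hloc : ∀ w ∈ T, 6 * δL w ≤
          6 * ((W.conductorExponent w : ℝ) * logNorm K w)
          + 2 * Real.log (max 1 (FinitePlace.mk w x⁻¹))
          + 3 * Real.log (max 1 (FinitePlace.mk w (1 - x)⁻¹)) + 6 * c w * logNorm K w := by
        intro w _
        have h := (szpiro_local_ineq w W hc4 hc6 x rfl (t₂ w) (t₃ w) (ht₂ w) (ht₃ w)).2
        simp only [hcdef, hδL, logNorm] at h ⊢
        linarith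
      have hsum := Finset.sum_le_sum hloc
      simp only [Finset.sum_add_distrib, ← Finset.mul_sum] at hsum
      rw [← hNsum T hTbad, hCsum T hT₆] at hsum
      linarith
    -- elimination
    have hΔ0 : 0 ≤ Δ := Finset.sum_nonneg fun w _ => by
      simp only [hδL]
      split_ifs
      · exact (logNorm_pos K w).le
      · exact le_rfl
    have hΔle : Δ ≤ 12 * N + 10 * Cabc' + 6 * L2 + 12 * C₁ := by nlinarith
    have hD : D ≤ 6 * N + 6 * ε * Δ + 6 * Cabc' + 3 * L2 + 6 * C₁ := by nlinarith
    have h72 : 72 * ε ≤ η := by linarith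
    rw [hCfin]
    nlinarith [mul_nonneg hε.le hΔ0, mul_nonneg hε.le hN0, mul_nonneg hε.le hCabc'0,
      mul_nonneg hε.le hL20, mul_nonneg hε.le hC₁0]

end Main

end WeierstrassCurve

end
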